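import Summits.HodgeConjecture.HodgeConjecture.Theorems.RigidUnwindingKummerEndgameFrameTransport
import Summits.HodgeConjecture.HodgeConjecture.Theses.RigidUnwinding

/-!
# Route RigidUnwinding — crux `KummerEndgame` (stmt-HodgeConjecture-14766), line `birth`: the crux from the trivialised endgame ALONE (stubs F + D discharged)

The skeleton `Cruxes/KummerEndgame/Lines/birth.lean` composes the crux
`RigidUnwinding.KummerEndgame` from three registered stubs: F (`FiniteEtaleTrivialisation`,
LANDED: `Theorems.stub_finiteEtaleTrivialisation`), D (`FrameDescent`, the transfer
`TrivialisedEndgame → FiniteEtaleTrivialisation → KummerEndgame`) and T (`TrivialisedEndgame`, the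
heart, open). This file proves **D with F already plugged in**:

* `kummerEndgame_of_trivialisedEndgame` — `TrivialisedEndgame → RigidUnwinding.KummerEndgame`
  (the crux BY NAME, the hypothesis being the body of the skeleton's `TrivialisedEndgame`
  verbatim). The line's lead closes stub D with
  `theorem stub_frameDescent := fun hT _ => Theorems.kummerEndgame_of_trivialisedEndgame hT`
  (the registered form of D names the skeleton-local `TrivialisedEndgame` /
  `FiniteEtaleTrivialisation`, which a `Theorems/` file cannot import; hence a helper).

Proof (the transfer D): take the finite étale cover `g : U' ⟶ U` of F; base-change the frame along
the fibre isomorphisms `ε_{t'} : (𝒴 ×_U U')_{t'} ≅ Y_{g t'}` — `e↑ = ε^* e ε⁻¹^*`, `e'↑`, `Φ↑` —;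
idempotency, `Alg` (`alg_transport_of_iso`), `Flat` (`flat_familyPullback_of_flat`), rationality
(`IsRationalClass.map`), Hodge bidegree (`isOfHodgeType_map_iff_of_iso`) and `Φ(im e) = im e'`
transfer; `U'` is a smooth irreducible quasi-projective curve
(`isQuasiProjectiveOver_of_isFinite_of_surjective`); the trivial-monodromy clause upstairs is F;
`TrivialisedEndgame` gives `Ψ↑` at every `t'`; for `t = g t'` (F: `g(ℂ)` onto) the conjugate
`Ψ = ε⁻¹^* Ψ↑ ε^*` is algebraic (`alg_transport_of_iso` along `ε⁻¹`) with `Ψ ∘ e_t = Φ_t ∘ e_t`.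
IRREDUCIBILITY of `L` (the crux's clause) is not used.

No definition, no named fact, no `sorry`; no Hodge theory beyond transport of types along
isomorphisms. `HC_CM` plays no role here; nothing here proves a case of the Hodge conjecture (the
heart `TrivialisedEndgame` stays a hypothesis).

References: [VoisinHodgeII2003] §3.1.2; [VoisinHodgeI2002] §9.2.1, §11.3.3; [SGA1] Exp. XII
Thm. 5.1; [Hartshorne1977] II.3 (base extension).
-/

noncomputable section

-- mandated namespace of this single-conjunct summit (as in the sibling `Theorems/*` files)
set_option linter.dupNamespace false

open CategoryTheory MonoidalCategory CartesianMonoidalCategory AlgebraicGeometry TopologicalSpace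
open Literature.AlgebraicGeometry.Motives Literature.AlgebraicGeometry.HodgeTheory
open Literature.AlgebraicTopology.SingularHomology

namespace Summit.HodgeConjecture.HodgeConjecture.Theorems

/-- **`KummerEndgame` from the trivialised endgame** (stub D of line `birth` with stub F plugged in):
if the constant-piece endgame `TrivialisedEndgame` holds over every smooth irreducible
quasi-projective complex curve, then `RigidUnwinding.KummerEndgame` holds — trivialise the finite
monodromy of `L = im e` on the finite étale cover of `Theorems.stub_finiteEtaleTrivialisation`,
base-change the frame along the fibre isomorphisms, run the endgame upstairs, and descend the
algebraic operator. [cite: VoisinHodgeII2003, §3.1.2] [cite: VoisinHodgeI2002, §9.2.1]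
[cite: SGA1, Exp. XII Thm. 5.1 (p. 333)] -/
theorem kummerEndgame_of_trivialisedEndgame
    (hT : ∀ (S 𝒴 : SchemeOver ℂ) (f : 𝒴 ⟶ S) (d k c : ℕ) (e : ∀ t : ComplexPoints S, complexBetti (fiberOver f t) k →ₗ[ℂ] complexBetti (fiberOver f t) k) (e' : ∀ t : ComplexPoints S, complexBetti (fiberOver f t) (k + 2 * c) →ₗ[ℂ] complexBetti (fiberOver f t) (k + 2 * c)) (Φ : ∀ t : ComplexPoints S, complexBetti (fiberOver f t) k →ₗ[ℂ] complexBetti (fiberOver f t) (k + 2 * c)), let Alg := fun (a q b : ℕ) (t : ComplexPoints S) (T : complexBetti (fiberOver f t) a →ₗ[ℂ] complexBetti (fiberOver f t) b) => ∃ ζ ∈ algebraicClasses (fiberOver f t ⊗ fiberOver f t) q, ∃ ω : complexBetti (fiberOver f t) (2 * d), ω ≠ 0 ∧ ∀ (b' : ℕ) (hb : b + b' = 2 * d) (hq : (a + 2 * q) + b' = 4 * d) (α : complexBetti (fiberOver f t) a) (β : complexBetti (fiberOver f t) b'), cupProduct hq (cupProduct (show a + 2 * q = a + 2 * q from rfl)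 (complexBetti.map (fst (fiberOver f t) (fiberOver f t)) a α) ζ) (complexBetti.map (snd (fiberOver f t) (fiberOver f t)) b' β) = cupProduct (show 2 * d + 2 * d = 4 * d by omega) (complexBetti.map (fst (fiberOver f t) (fiberOver f t)) (2 * d) ω) (complexBetti.map (snd (fiberOver f t) (fiberOver f t)) (2 * d) (cupProduct hb (T α) β)); let Flat := fun (a b : ℕ) (T : ∀ t : ComplexPoints S, complexBetti (fiberOver f t) a →ₗ[ℂ] complexBetti (fiberOver f t) b) => ∀ (s t : ComplexPoints S) (γ : Path s t) (α : complexBetti (fiberOver f s) a) (β : complexBetti (fiberOver f t) a), IsContinuationAlong γ α β → IsContinuationAlong γ (T s α) (T t β); IsQuasiProjectiveOver S → AlgebraicGeometry.SmoothOfRelativeDimension 1 S.hom → IrreducibleSpace S.left → IsSmoothProjectiveFamily f d → (∀ t, e t ∘ₗ e t = e t ∧ Alg k d k t (e t)) → Flat k k e → (∀ t, e' t ∘ₗ e' t = e' t ∧ Alg (k + 2 * c) d (k + 2 * c) t (e' t)) → Flat (k + 2 * c) (k + 2 * c) e' → Flat k (k + 2 * c) Φ → (∀ t x, IsRationalClass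 x → IsRationalClass (Φ t x)) → (∀ t (p q : ℕ), p + q = k → ∀ x, IsOfHodgeType d (fiberOver f t) k p q x → IsOfHodgeType d (fiberOver f t) (k + 2 * c) (p + c) (q + c) (Φ t x)) → (∀ t, Submodule.map (Φ t) (LinearMap.range (e t)) = LinearMap.range (e' t)) → (∀ (s : ComplexPoints S) (γ : Path s s) (α β : complexBetti (fiberOver f s) k), α ∈ LinearMap.range (e s) → IsContinuationAlong γ α β → β = α) → ∀ t, ∃ Ψ : complexBetti (fiberOver f t) k →ₗ[ℂ] complexBetti (fiberOver f t) (k + 2 * c), Alg k (d + c) (k + 2 * c) t Ψ ∧ Ψ ∘ₗ e t = Φ t ∘ₗ e t) :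
    Summit.HodgeConjecture.HodgeConjecture.Theses.RigidUnwinding.KummerEndgame := by
  intro U 𝒴 j f d k c e e' Φ Alg Flat hj hne hf he hFe he' hFe' hFΦ hrat hhdg hrg _hirr hfin t
  -- Step 1: the trivialising finite étale cover (stub F)
  obtain ⟨U', g, hgfin, hget, hU'irr, hgsurj, htriv⟩ :=
    stub_finiteEtaleTrivialisation U 𝒴 j f d k e hj hne hf hFe hfin
  -- Step 2: the bases and the local systems
  obtain ⟨s₀⟩ := hne
  haveI := hj
  haveI : Nonempty U.left := ⟨s₀.pt⟩
  haveI : SmoothOfRelativeDimension 1 U.hom :=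
    smoothOfRelativeDimension_one_of_isOpenImmersion_projectiveLine j
  haveI : Smooth U.hom := SmoothOfRelativeDimension.smooth 1 U.hom
  haveI : LocallyOfFiniteType U.hom := inferInstance
  haveI : IrreducibleSpace U.left := irreducibleSpace_of_isOpenImmersion_projectiveLine j
  have hUqp : IsQuasiProjectiveOver U := isQuasiProjectiveOver_of_isOpenImmersion_projectiveLine j
  haveI : IsSeparated U.hom := isSeparated_of_isOpenImmersion_projectiveLine j
  have hU := isCohomologicallyLocallyTrivialOn_univ_of_isSmoothProjectiveFamily f 1 hf hUqp
  haveI := hgfin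
  haveI := hget
  haveI := hU'irr
  haveI hg0 : SmoothOfRelativeDimension 0 g.left := inferInstance
  haveI : Smooth g.left := SmoothOfRelativeDimension.smooth 0 _
  haveI hU'd : SmoothOfRelativeDimension 1 U'.hom := by
    have h : SmoothOfRelativeDimension (0 + 1) (g.left ≫ U.hom) := inferInstance
    rw [Over.w] at h
    simpa using h
  haveI : Smooth U'.hom := SmoothOfRelativeDimension.smooth 1 _
  haveI : LocallyOfFiniteType U'.hom := inferInstance
  haveI : Nonempty U'.left := by
    obtain ⟨s₀', -⟩ := hgsurj s₀
    exact ⟨s₀'.pt⟩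
  haveI : Surjective g.left := surjective_of_isFinite_of_etale_of_irreducible g.left
  haveI : IsReduced U.left := isReduced_of_smooth_over_field U.hom
  haveI : IsReduced U'.left := isReduced_of_smooth_over_field U'.hom
  haveI : IsIntegral U.left := isIntegral_of_irreducibleSpace_of_isReduced U.left
  haveI : IsIntegral U'.left := isIntegral_of_irreducibleSpace_of_isReduced U'.left
  have hU'qp : IsQuasiProjectiveOver U' := isQuasiProjectiveOver_of_isFinite_of_surjective g hUqp
  set f' := familyPullback.snd f g with hf'def
  have hf' : IsSmoothProjectiveFamily f' d := hf.familyPullback_snd g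
  have hU' := isCohomologicallyLocallyTrivialOn_univ_of_isSmoothProjectiveFamily f' 1 hf' hU'qp
  -- Step 3: the frame upstairs, conjugated along the fibre isomorphisms `ε_{t'}`
  let ε : ∀ t' : ComplexPoints U', fiberOver f' t' ≅ fiberOver f (AlgPoints.map g t') :=
    fun t' => fiberOverFamilyPullbackIso f g t'
  have hinv_hom : ∀ (t' : ComplexPoints U') (i : ℕ) (x : complexBetti (fiberOver f' t') i),
      complexBetti.map (ε t').hom i (complexBetti.map (ε t').inv i x) = x :=
    fun t' i x => (ε t').complexBetti_map_hom_map_inv i x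
  have hhom_inv : ∀ (t' : ComplexPoints U') (i : ℕ) (y : complexBetti (fiberOver f (AlgPoints.map g t')) i),
      complexBetti.map (ε t').inv i (complexBetti.map (ε t').hom i y) = y :=
    fun t' i y => (ε t').complexBetti_map_inv_map_hom i y
  let eU : ∀ t' : ComplexPoints U', complexBetti (fiberOver f' t') k →ₗ[ℂ] complexBetti (fiberOver f' t') k :=
    fun t' => (complexBetti.map (ε t').hom k).hom ∘ₗ e (AlgPoints.map g t') ∘ₗ
      (complexBetti.map (ε t').inv k).hom
  let e'U : ∀ t' : ComplexPoints U',
      complexBetti (fiberOver f' t') (k + 2 * c) →ₗ[ℂ] complexBetti (fiberOver f' t') (k + 2 * c) :=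
    fun t' => (complexBetti.map (ε t').hom (k + 2 * c)).hom ∘ₗ e' (AlgPoints.map g t') ∘ₗ
      (complexBetti.map (ε t').inv (k + 2 * c)).hom
  let ΦU : ∀ t' : ComplexPoints U',
      complexBetti (fiberOver f' t') k →ₗ[ℂ] complexBetti (fiberOver f' t') (k + 2 * c) :=
    fun t' => (complexBetti.map (ε t').hom (k + 2 * c)).hom ∘ₗ Φ (AlgPoints.map g t') ∘ₗ
      (complexBetti.map (ε t').inv k).hom
  have heU : ∀ t' x, eU t' x = complexBetti.map (ε t').hom k (e _ (complexBetti.map (ε t').inv k x)) :=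
    fun _ _ => rfl
  have he'U : ∀ t' x, e'U t' x =
      complexBetti.map (ε t').hom (k + 2 * c) (e' _ (complexBetti.map (ε t').inv (k + 2 * c) x)) :=
    fun _ _ => rfl
  have hΦU : ∀ t' x, ΦU t' x =
      complexBetti.map (ε t').hom (k + 2 * c) (Φ _ (complexBetti.map (ε t').inv k x)) :=
    fun _ _ => rfl
  -- idempotency transfers
  have hidem : ∀ {i : ℕ} (T : ∀ t : ComplexPoints U, complexBetti (fiberOver f t) i →ₗ[ℂ]
      complexBetti (fiberOver f t) i), (∀ t, T t ∘ₗ T t = T t) → ∀ t' : ComplexPoints U',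
      ((complexBetti.map (ε t').hom i).hom ∘ₗ T (AlgPoints.map g t') ∘ₗ
          (complexBetti.map (ε t').inv i).hom) ∘ₗ
        ((complexBetti.map (ε t').hom i).hom ∘ₗ T (AlgPoints.map g t') ∘ₗ
          (complexBetti.map (ε t').inv i).hom) =
      (complexBetti.map (ε t').hom i).hom ∘ₗ T (AlgPoints.map g t') ∘ₗ
        (complexBetti.map (ε t').inv i).hom := by
    intro i T hTT t'
    apply LinearMap.ext
    intro x
    change complexBetti.map (ε t').hom i (T _ (complexBetti.map (ε t').inv i
      (complexBetti.map (ε t').hom i (T _ (complexBetti.map (ε t').inv i x))))) =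
      complexBetti.map (ε t').hom i (T _ (complexBetti.map (ε t').inv i x))
    rw [hhom_inv, ← LinearMap.comp_apply (T _) (T _), hTT]
  -- ranges transfer: `im (ε^* T ε⁻¹^*) = ε^* (im T)`
  have hrangeU : ∀ {i : ℕ} (T : ∀ t : ComplexPoints U, complexBetti (fiberOver f t) i →ₗ[ℂ]
      complexBetti (fiberOver f t) i) (t' : ComplexPoints U'),
      LinearMap.range ((complexBetti.map (ε t').hom i).hom ∘ₗ T (AlgPoints.map g t') ∘ₗ
        (complexBetti.map (ε t').inv i).hom) =
      Submodule.map (complexBetti.map (ε t').hom i).hom (LinearMap.range (T (AlgPoints.map g t'))) := by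
    intro i T t'
    have hsurj : Function.Surjective (complexBetti.map (ε t').inv i).hom :=
      fun y => ⟨complexBetti.map (ε t').hom i y, hhom_inv t' i y⟩
    rw [LinearMap.range_comp, LinearMap.range_comp, LinearMap.range_eq_top.2 hsurj, Submodule.map_top]
  -- Step 4: the trivialised endgame upstairs
  have main := hT U' (familyPullback f g) f' d k c eU e'U ΦU hU'qp hU'd hU'irr hf'
    (fun t' => ⟨hidem e (fun t => (he t).1) t', alg_transport_of_iso (ε t') (e _) (he _).2⟩)
    (flat_familyPullback_of_flat f g hU hU' e hFe)
    (fun t' => ⟨hidem e' (fun t => (he' t).1) t', alg_transport_of_iso (ε t') (e' _) (he' _).2⟩)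
    (flat_familyPullback_of_flat f g hU hU' e' hFe')
    (flat_familyPullback_of_flat f g hU hU' Φ hFΦ)
    (fun t' x hx => by
      rw [hΦU]
      exact (hrat _ _ (hx.map _)).map _)
    (fun t' p q hpq x hx => by
      rw [hΦU, isOfHodgeType_map_iff_of_iso (ε t')]
      refine hhdg _ p q hpq _ ((isOfHodgeType_map_iff_of_iso (ε t')).1 ?_)
      rwa [hinv_hom])
    (fun t' => by
      change Submodule.map (ΦU t') (LinearMap.range ((complexBetti.map (ε t').hom k).hom ∘ₗ
        e (AlgPoints.map g t') ∘ₗ (complexBetti.map (ε t').inv k).hom)) =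
        LinearMap.range ((complexBetti.map (ε t').hom (k + 2 * c)).hom ∘ₗ e' (AlgPoints.map g t') ∘ₗ
          (complexBetti.map (ε t').inv (k + 2 * c)).hom)
      rw [hrangeU e, hrangeU e', ← hrg (AlgPoints.map g t'), Submodule.map_comp, Submodule.map_comp]
      congr 2
      ext y
      constructor
      · intro hy
        obtain ⟨z, hz, rfl⟩ := Submodule.mem_map.1 hy
        obtain ⟨w, hw, rfl⟩ := Submodule.mem_map.1 hz
        change complexBetti.map (ε t').inv k (complexBetti.map (ε t').hom k w) ∈ _
        rwa [hhom_inv]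
      · intro hy
        exact Submodule.mem_map.2 ⟨complexBetti.map (ε t').hom k y,
          Submodule.mem_map.2 ⟨y, hy, rfl⟩, hhom_inv t' k y⟩)
    (fun s' γ' α' β' hα' hcont => by
      obtain ⟨y, rfl⟩ := hα'
      rw [heU] at hcont ⊢
      exact htriv s' γ' _ β' ⟨_, rfl⟩ hcont)
  -- Step 5: descend at `t = g t'`
  obtain ⟨t', rfl⟩ := hgsurj t
  obtain ⟨ΨU, hΨalg, hΨeq⟩ := main t'
  refine ⟨(complexBetti.map (ε t').symm.hom (k + 2 * c)).hom ∘ₗ ΨU ∘ₗ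
    (complexBetti.map (ε t').symm.inv k).hom, alg_transport_of_iso (ε t').symm ΨU hΨalg, ?_⟩
  apply LinearMap.ext
  intro x
  have h1 := LinearMap.congr_fun hΨeq (complexBetti.map (ε t').hom k x)
  change ΨU (complexBetti.map (ε t').hom k (e _ (complexBetti.map (ε t').inv k
      (complexBetti.map (ε t').hom k x)))) =
    complexBetti.map (ε t').hom (k + 2 * c) (Φ _ (complexBetti.map (ε t').inv k
      (complexBetti.map (ε t').hom k (e _ (complexBetti.map (ε t').inv k
        (complexBetti.map (ε t').hom k x)))))) at h1
  rw [hhom_inv] at h1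
  rw [hhom_inv] at h1
  change complexBetti.map (ε t').inv (k + 2 * c) (ΨU (complexBetti.map (ε t').hom k (e _ x))) =
    Φ _ (e _ x)
  rw [h1, hhom_inv]

end Summit.HodgeConjecture.HodgeConjecture.Theorems

end
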